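import Summits.CriticalPhenomena.PercolationContinuityZ3.Theorems.Transplant.D4SKDefs
import Summits.CriticalPhenomena.PercolationContinuityZ3.Theorems.Transplant.Slab111SKBits
import HarnessLib

/-!
# Diamond film `D_4` certificate, II: SOUNDNESS OF THE BITBOARD PRIMITIVES — neighbourhood masks are made of bonds, reachable bits are ends of index walks,
re-validated index lists are duplicate-free adjacency chains

builds on p205010 (kernel theorem, internal audit signed; external expert review pending) — NOT used in this file.  Lane `prim-bschramm`, seat `prim-bschramm-p2` (gen 42; class C1b;
memo `HOME/bschramm/P2-LATTICES.md` §150); helper file (`--supports stmt-CriticalPhenomena-4575 --as helper`).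
«TriFilmSKBits» for the `D_4` layout of «D4SKDefs»: the adjacency relation is the context's `adjB` (tag-aware); **`testBit_nbh`** (a bit of `C.nbh m` is a universe vertex adjacent to a bit
of `m` — the one layout-specific proof: horizontal shifts by `12` among tag-`0` bits, vertical shifts by `1` among vertical-capable bits with re-tagging by `144`), then verbatim:
`IsWalkIn`, `reachGo_sound`, **`reach_sound`**, **`pathOK_sound`**.
[cite: DuminilCopinSidoraviciusTassion2016, §2.3 (proof of Fact 2)]
-/

namespace Summit.CriticalPhenomena.PercolationContinuityZ3.Theorems.Transplant

namespace DiamondFilm.SK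

open Slab111.SK (bitOf sdiff lowIdx maskBelow maskOfList endsOK orFold rd rdMask testBit_bitOf testBit_sdiff testBit_maskBelow of_testBit_maskBelow testBit_maskBelow_of)

variable (C : Ctx)

/-! ## §1 Adjacency -/

/-- Index adjacency as a proposition (the context's `adjB`). [folklore] -/
def AdjRel (i j : ℕ) : Prop := C.adjB i j = true

/-- The digit form of `adjB`. [folklore] -/
theorem adjB_iff {i j : ℕ} : C.adjB i j = true ↔ C.validB i = true ∧ C.validB j = true ∧
    ((dT i = 0 ∧ dT j = 0 ∧ dB i = dB j ∧ (dA i = dA j + 1 ∨ dA j = dA i + 1)) ∨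
      (dA i = dA j ∧ (dB i = dB j + 1 ∨ dB j = dB i + 1) ∧ C.vcapB i = true ∧ C.vcapB j = true)) := by
  unfold Ctx.adjB
  simp only [Bool.and_eq_true, Bool.or_eq_true, beq_iff_eq, and_assoc]

/-- `AdjRel` is symmetric. [folklore] -/
theorem AdjRel.symm {C : Ctx} {i j : ℕ} (h : AdjRel C i j) : AdjRel C j i := by
  unfold AdjRel at *
  rw [adjB_iff] at h ⊢
  obtain ⟨hi, hj, h⟩ := h
  refine ⟨hj, hi, ?_⟩
  rcases h with ⟨h1, h2, h3, h4⟩ | ⟨h1, h2, h3, h4⟩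
  · exact Or.inl ⟨h2, h1, h3.symm, h4.symm⟩
  · exact Or.inr ⟨h1.symm, h2.symm, h4, h3⟩

/-! ## §2 Neighbourhoods and reachability -/

/-- `eeB` in arithmetic form. [folklore] -/
theorem eeB_iff (i : ℕ) : C.eeB i = true ↔ (C.c0 + (i % 144) / 12 + 1) % 2 = 0 ∧ (C.c1 + i % 12 + 1) % 2 = 0 := by
  unfold Ctx.eeB dA dB; simp only [Bool.and_eq_true, beq_iff_eq]

/-- `validB` in arithmetic form. [folklore] -/
theorem validB_iff (i : ℕ) : C.validB i = true ↔ i < 288 ∧ (i % 144) / 12 ≤ 10 ∧ i % 12 ≤ 10 ∧ (i / 144 = 0 ∨ C.eeB i = true) := by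
  unfold Ctx.validB dA dB dT
  simp only [Bool.and_eq_true, decide_eq_true_eq, Bool.or_eq_true, beq_iff_eq, and_assoc]

/-- The arithmetic digit bounds of a valid index. [folklore] -/
theorem digits (i : ℕ) (h : C.validB i = true) : i < 288 ∧ (i % 144) / 12 ≤ 10 ∧ i % 12 ≤ 10 := by
  have := (validB_iff C i).1 h; exact ⟨this.1, this.2.1, this.2.2.1⟩

/-- `vcapB` in arithmetic form. [folklore] -/
theorem vcapB_iff (i : ℕ) : C.vcapB i = true ↔ C.validB i = true ∧ ((C.eeB i = true ∧ i / 144 = 1) ∨ (C.eeB i = false ∧ i / 144 = 0)) := by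
  unfold Ctx.vcapB dT
  cases h : C.eeB i <;> simp

/-- `adjB` in arithmetic form. [folklore] -/
theorem adjB_iff' {i j : ℕ} : C.adjB i j = true ↔ C.validB i = true ∧ C.validB j = true ∧
    ((i / 144 = 0 ∧ j / 144 = 0 ∧ i % 12 = j % 12 ∧ ((i % 144) / 12 = (j % 144) / 12 + 1 ∨ (j % 144) / 12 = (i % 144) / 12 + 1)) ∨
      ((i % 144) / 12 = (j % 144) / 12 ∧ (i % 12 = j % 12 + 1 ∨ j % 12 = i % 12 + 1) ∧ C.vcapB i = true ∧ C.vcapB j = true)) := by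
  rw [adjB_iff]; rfl

/-- `eeB` only sees the column digits. [folklore] -/
theorem eeB_of_digits {i k : ℕ} (ha : (i % 144) / 12 = (k % 144) / 12) (hb : i % 12 = k % 12) : C.eeB i = C.eeB k := by
  unfold Ctx.eeB dA dB; rw [ha, hb]

/-- **A bit of the neighbourhood mask has an adjacent bit in the argument** (and lies in the universe). [folklore] -/
theorem testBit_nbh {m j : ℕ} (h : (C.nbh m).testBit j = true) : C.univ.testBit j = true ∧ ∃ i, m.testBit i = true ∧ AdjRel C i j := by
  unfold Ctx.nbh at h
  rw [Nat.testBit_land, Bool.and_eq_true] at h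
  refine ⟨h.2, ?_⟩
  have hu : C.validB j = true := (of_testBit_maskBelow (p := C.validB) h.2).2
  have hdj := digits C j hu
  have h1 := h.1
  rw [Nat.testBit_lor, Bool.or_eq_true] at h1
  unfold AdjRel
  rcases h1 with h1 | h1
  · -- horizontal part: `j` and its source are tag-`0` bits at distance `12`
    rw [Nat.testBit_land, Bool.and_eq_true] at h1
    obtain ⟨hs, hT0j⟩ := h1
    obtain ⟨-, hT0j⟩ := of_testBit_maskBelow hT0j
    simp only [Bool.and_eq_true, beq_iff_eq] at hT0j
    have htj : j / 144 = 0 := hT0j.2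
    rw [Nat.testBit_lor, Bool.or_eq_true, Nat.testBit_shiftLeft, Nat.testBit_shiftRight, Bool.and_eq_true, decide_eq_true_eq] at hs
    have key : ∀ i, (m &&& C.T0).testBit i = true → (j = i + 12 ∨ i = j + 12) → ∃ i, m.testBit i = true ∧ C.adjB i j = true := by
      intro i hi hij
      rw [Nat.testBit_land, Bool.and_eq_true] at hi
      obtain ⟨hmi, hT0i⟩ := hi
      obtain ⟨-, hT0i⟩ := of_testBit_maskBelow hT0i
      simp only [Bool.and_eq_true, beq_iff_eq] at hT0i
      have hti : i / 144 = 0 := hT0i.2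
      have hdi := digits C i hT0i.1
      refine ⟨i, hmi, (adjB_iff' C).2 ⟨hT0i.1, hu, Or.inl ⟨hti, htj, by omega, by omega⟩⟩⟩
    rcases hs with ⟨hge, hs⟩ | hs
    · exact key (j - 12) hs (Or.inl (by omega))
    · exact key (12 + j) hs (Or.inr (by omega))
  · -- vertical part
    -- sources: vertical-capable bits of `m`, as column indices `k < 144`
    have hmv : ∀ k, ((m &&& C.VX) ||| ((m >>> 144) &&& C.EEcol)).testBit k = true →
        ∃ i, m.testBit i = true ∧ C.vcapB i = true ∧ (i % 144) / 12 = (k % 144) / 12 ∧ i % 12 = k % 12 ∧ k < 144 := by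
      intro k hk
      rw [Nat.testBit_lor, Bool.or_eq_true, Nat.testBit_land, Nat.testBit_land, Bool.and_eq_true, Bool.and_eq_true, Nat.testBit_shiftRight] at hk
      rcases hk with ⟨hmk, hVX⟩ | ⟨hmk, hEE⟩
      · obtain ⟨-, hVX⟩ := of_testBit_maskBelow hVX
        simp only [Bool.and_eq_true, beq_iff_eq, Bool.not_eq_true'] at hVX
        obtain ⟨⟨hvk, htk⟩, heek⟩ := hVX
        have hdk := digits C k hvk
        have htk' : k / 144 = 0 := htk
        exact ⟨k, hmk, (vcapB_iff C k).2 ⟨hvk, Or.inr ⟨heek, htk'⟩⟩, rfl, rfl, by omega⟩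
      · obtain ⟨-, hEE⟩ := of_testBit_maskBelow hEE
        simp only [Bool.and_eq_true, decide_eq_true_eq] at hEE
        obtain ⟨⟨hk144, hvk⟩, heek⟩ := hEE
        have hdk := digits C k hvk
        have hee' : C.eeB (144 + k) = true := by rw [eeB_of_digits C (i := 144 + k) (k := k) (by omega) (by omega)]; exact heek
        have hv' : C.validB (144 + k) = true := (validB_iff C _).2 ⟨by omega, by omega, by omega, Or.inr hee'⟩
        exact ⟨144 + k, hmk, (vcapB_iff C _).2 ⟨hv', Or.inl ⟨hee', by omega⟩⟩, by omega, by omega, hk144⟩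
    -- targets
    have htg : ∀ k, ((((m &&& C.VX) ||| ((m >>> 144) &&& C.EEcol)) <<< 1) ||| (((m &&& C.VX) ||| ((m >>> 144) &&& C.EEcol)) >>> 1)).testBit k = true →
        C.validB k = true → k < 144 → C.vcapB j = true → (j % 144) / 12 = (k % 144) / 12 → j % 12 = k % 12 →
          ∃ i, m.testBit i = true ∧ C.adjB i j = true := by
      intro k hk hvk hk144 hvj haj hbj
      rw [Nat.testBit_lor, Bool.or_eq_true, Nat.testBit_shiftLeft, Nat.testBit_shiftRight, Bool.and_eq_true, decide_eq_true_eq] at hk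
      have hdk := digits C k hvk
      have aux : ∀ k', ((m &&& C.VX) ||| ((m >>> 144) &&& C.EEcol)).testBit k' = true → (k = k' + 1 ∨ k' = k + 1) →
          ∃ i, m.testBit i = true ∧ C.adjB i j = true := by
        intro k' hk' hkk'
        obtain ⟨i, hmi, hvi, hai, hbi, hlt⟩ := hmv k' hk'
        have hvi' : C.validB i = true := ((vcapB_iff C i).1 hvi).1
        have hdi := digits C i hvi'
        refine ⟨i, hmi, (adjB_iff' C).2 ⟨hvi', hu, Or.inr ⟨by omega, by omega, hvi, hvj⟩⟩⟩
      rcases hk with ⟨hge, hk⟩ | hk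
      · exact aux (k - 1) hk (Or.inl (by omega))
      · exact aux (1 + k) hk (Or.inr (by omega))
    rw [Nat.testBit_lor, Bool.or_eq_true] at h1
    rcases h1 with h1 | h1
    · rw [Nat.testBit_land, Bool.and_eq_true] at h1
      obtain ⟨htgj, hNE⟩ := h1
      obtain ⟨-, hNE⟩ := of_testBit_maskBelow hNE
      simp only [Bool.and_eq_true, decide_eq_true_eq, Bool.not_eq_true'] at hNE
      obtain ⟨⟨hj144, hvj'⟩, hnej⟩ := hNE
      have hvj : C.vcapB j = true := (vcapB_iff C j).2 ⟨hu, Or.inr ⟨hnej, by omega⟩⟩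
      exact htg j htgj hu hj144 hvj rfl rfl
    · rw [Nat.testBit_shiftLeft, Bool.and_eq_true, decide_eq_true_eq, Nat.testBit_land, Bool.and_eq_true] at h1
      obtain ⟨hge, htgj, hEEj⟩ := h1
      obtain ⟨-, hEEj⟩ := of_testBit_maskBelow hEEj
      simp only [Bool.and_eq_true, decide_eq_true_eq] at hEEj
      obtain ⟨⟨hlt, hvj'⟩, heej'⟩ := hEEj
      have heej : C.eeB j = true := by rw [eeB_of_digits C (i := j) (k := j - 144) (by omega) (by omega)]; exact heej'
      have hvj : C.vcapB j = true := (vcapB_iff C j).2 ⟨hu, Or.inl ⟨heej, by omega⟩⟩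
      exact htg (j - 144) htgj hvj' hlt hvj (by omega) (by omega)

/-- **An index walk inside a region**: an `AdjRel`-chain `s :: l` all of whose members are bits of `R`. [folklore] -/
def IsWalkIn (R : ℕ) (s : ℕ) (l : List ℕ) : Prop := (s :: l).IsChain (AdjRel C) ∧ ∀ x ∈ s :: l, R.testBit x = true

/-- The end of the walk `s :: l`. [folklore] -/
def walkEnd (s : ℕ) (l : List ℕ) : ℕ := (s :: l).getLast (List.cons_ne_nil _ _)

/-- Extending a walk by an adjacent region vertex. [folklore] -/
theorem IsWalkIn.snoc {C : Ctx} {R s : ℕ} {l : List ℕ} (h : IsWalkIn C R s l) {j : ℕ} (hadj : AdjRel C (walkEnd s l) j) (hj : R.testBit j = true) :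
    IsWalkIn C R s (l ++ [j]) ∧ walkEnd s (l ++ [j]) = j := by
  refine ⟨⟨?_, ?_⟩, ?_⟩
  · have : s :: (l ++ [j]) = (s :: l) ++ [j] := rfl
    rw [this, List.isChain_append]
    refine ⟨h.1, List.IsChain.singleton _, fun x hx y hy => ?_⟩
    rw [List.getLast?_eq_some_getLast (List.cons_ne_nil _ _), Option.mem_def, Option.some.injEq] at hx
    simp only [List.head?_cons, Option.mem_def, Option.some.injEq] at hy
    subst hx hy; exact hadj
  · intro x hx
    simp only [List.mem_cons, List.mem_append, List.not_mem_nil, or_false] at hx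
    rcases hx with rfl | hx | rfl
    · exact h.2 _ (by simp)
    · exact h.2 _ (List.mem_cons_of_mem _ hx)
    · exact hj
  · show ((s :: l) ++ [j]).getLast _ = j
    simp

/-- **SOUNDNESS OF `reachGo`**. [folklore] -/
theorem reachGo_sound (R src : ℕ) :
    ∀ (f cur : ℕ), (∀ j, cur.testBit j = true → ∃ s l, src.testBit s = true ∧ IsWalkIn C R s l ∧ walkEnd s l = j) →
      ∀ j, (C.reachGo R f cur).testBit j = true → ∃ s l, src.testBit s = true ∧ IsWalkIn C R s l ∧ walkEnd s l = j := by
  intro f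
  induction f with
  | zero => intro cur hcur j hj; exact hcur j hj
  | succ f ih =>
    intro cur hcur j hj
    simp only [Ctx.reachGo] at hj
    have hnxt : ∀ j, ((cur ||| C.nbh cur) &&& R).testBit j = true → ∃ s l, src.testBit s = true ∧ IsWalkIn C R s l ∧ walkEnd s l = j := by
      intro j hj
      rw [Nat.testBit_land, Bool.and_eq_true, Nat.testBit_lor, Bool.or_eq_true] at hj
      rcases hj with ⟨hj | hj, hR⟩
      · exact hcur j hj
      · obtain ⟨-, i, hi, hadj⟩ := testBit_nbh C hj
        obtain ⟨s, l, hs, hw, he⟩ := hcur i hi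
        subst he
        exact ⟨s, l ++ [j], hs, (hw.snoc hadj hR).1, (hw.snoc hadj hR).2⟩
    cases hb : ((cur ||| C.nbh cur) &&& R == cur)
    · rw [hb] at hj; exact ih _ hnxt j hj
    · rw [hb] at hj; exact hcur j hj

/-- **SOUNDNESS OF `reach`**: a reachable bit is the end of an index walk inside the region from a bit of `src ∩ region`. [folklore] -/
theorem reach_sound {R src j : ℕ} (h : (C.reach R src).testBit j = true) :
    ∃ s l, src.testBit s = true ∧ R.testBit s = true ∧ IsWalkIn C R s l ∧ walkEnd s l = j := by
  unfold Ctx.reach at h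
  have base : ∀ j, (src &&& R).testBit j = true → ∃ s l, (src &&& R).testBit s = true ∧ IsWalkIn C R s l ∧ walkEnd s l = j := by
    intro j hj
    refine ⟨j, [], hj, ⟨List.IsChain.singleton _, fun x hx => ?_⟩, rfl⟩
    simp only [List.mem_cons, List.not_mem_nil, or_false] at hx
    subst hx
    rw [Nat.testBit_land, Bool.and_eq_true] at hj
    exact hj.2
  obtain ⟨s, l, hs, hw, he⟩ := reachGo_sound C R (src &&& R) 300 _ base j h
  rw [Nat.testBit_land, Bool.and_eq_true] at hs
  exact ⟨s, l, hs.1, hs.2, hw, he⟩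

/-! ## §3 Re-validated paths -/

/-- **SOUNDNESS OF `pathOK`**: an `AdjRel`-chain without repetitions, inside `reg`, off `seen`. [folklore] -/
theorem pathOK_sound (reg : ℕ) : ∀ (l : List ℕ) (seen : ℕ), C.pathOK reg l seen = true →
    l.IsChain (AdjRel C) ∧ l.Nodup ∧ ∀ x ∈ l, reg.testBit x = true ∧ seen.testBit x = false
  | [], _, _ => ⟨List.IsChain.nil, List.nodup_nil, fun _ h => nomatch h⟩
  | [i], seen, h => by
    simp only [Ctx.pathOK, Bool.and_eq_true, Bool.not_eq_true'] at h
    exact ⟨List.IsChain.singleton _, List.nodup_singleton _, fun x hx => by simp only [List.mem_singleton] at hx; subst hx; exact h⟩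
  | i :: j :: rest, seen, h => by
    simp only [Ctx.pathOK, Bool.and_eq_true, Bool.not_eq_true'] at h
    obtain ⟨⟨⟨hi, hsi⟩, hij⟩, hrest⟩ := h
    obtain ⟨hch, hnd, hmem⟩ := pathOK_sound reg (j :: rest) (seen ||| bitOf i) hrest
    refine ⟨List.isChain_cons_cons.2 ⟨hij, hch⟩, List.nodup_cons.2 ⟨fun hmi => ?_, hnd⟩, fun x hx => ?_⟩
    · have := (hmem i hmi).2
      rw [Nat.testBit_lor, testBit_bitOf] at this
      simp at this
    · rcases List.mem_cons.1 hx with rfl | hx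
      · exact ⟨hi, hsi⟩
      · have := hmem x hx
        rw [Nat.testBit_lor, Bool.or_eq_false_iff] at this
        exact ⟨this.1, this.2.1⟩

end DiamondFilm.SK

end Summit.CriticalPhenomena.PercolationContinuityZ3.Theorems.Transplant
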